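import Summits.AtomisticToContinuum.FouriersLaw.Theses.LocalOhmBV
import Mathlib.Analysis.Calculus.BumpFunction.Convolution
import Mathlib.Analysis.Calculus.BumpFunction.FiniteDimension
import Summits.AtomisticToContinuum.FouriersLaw.Theorems.ParityLiouvilleSeedWindowLimitMollify

/-!
# Mollification of `C¹` profiles with polynomial bounds

Helper file for stub `stub_finiteResponsePackage` (S2a) of the birth line of crux `LocalOhmBV.LocalOhm`
(item stmt-AtomisticToContinuum-12009), clause (a3) (weak stationarity of the transported Liouville
derivative of `C¹` polynomially bounded cylinders): weak steady states are tested on `C^∞` functions, the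
clause quantifies over `C¹` profiles `G` with `|G|, ‖DG‖ ≤ C₀ (1 + ‖y‖)^m`. The tree's
`WindowLimit.exists_smooth_approx_of_contDiff_one` mollifies `C¹` profiles with BOUNDED values and
gradient; here the same is done under polynomial bounds, on a finite-dimensional real normed space `E`:

* `hasFDerivAt_bump_convolution_of_contDiff_one`, `fderiv_bump_convolution_apply_of_contDiff_one` —
  `D(φ ⋆ g) = φ ⋆ Dg` for ANY `C¹` profile (the gradient is bounded on compact sets, which is all the
  domination needs);
* `abs_bump_convolution_le_of_polyBound`, `norm_fderiv_bump_convolution_le_of_polyBound` — mollification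
  at scale `≤ 1` preserves polynomial growth (constant `2^m C₀`);
* `exists_smooth_approx_of_contDiff_one_polyBound` — smooth approximants with the same growth and
  pointwise convergence of values and directional derivatives.

No definitions.
-/

set_option autoImplicit false

noncomputable section

namespace Summit.AtomisticToContinuum.FouriersLaw.Theorems.LocalOhmBirth

open MeasureTheory Filter Topology Set Metric Function
open scoped BigOperators ContDiff Convolution
open Summit.AtomisticToContinuum.FouriersLaw.Theorems.WindowLimit (bump_convolution_apply
  integrable_bump_smul_fderiv)

/-! ## Mollification of `C¹` profiles with polynomial bounds -/

section Mollify

variable {E : Type*} [NormedAddCommGroup E] [NormedSpace ℝ E] [FiniteDimensional ℝ E] [MeasurableSpace E]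
  [BorelSpace E] (μ : Measure E) [μ.IsAddHaarMeasure]

/-- **Differentiation under the integral sign for the mollification of ANY `C¹` profile**:
`D(φ ⋆ g)(x₀) = ∫ φ(t) Dg(x₀ - t) dt` (the gradient is bounded on compact sets, which is all the
domination needs). [folklore] -/
theorem hasFDerivAt_bump_convolution_of_contDiff_one (φ : ContDiffBump (0 : E)) {g : E → ℝ}
    (hg : ContDiff ℝ 1 g) (x₀ : E) :
    HasFDerivAt (φ.normed μ ⋆[ContinuousLinearMap.lsmul ℝ ℝ, μ] g)
      (∫ t, φ.normed μ t • fderiv ℝ g (x₀ - t) ∂μ) x₀ := by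
  have hgd : Differentiable ℝ g := hg.differentiable one_ne_zero
  have hgc : Continuous g := hg.continuous
  have hDc : Continuous (fderiv ℝ g) := hg.continuous_fderiv one_ne_zero
  have hφc : Continuous (φ.normed μ) := φ.continuous_normed
  -- a bound for the gradient on the relevant compact set
  obtain ⟨M', hM'⟩ := (isCompact_closedBall x₀ (1 + φ.rOut)).exists_bound_of_continuousOn hDc.continuousOn
  have hM'0 : 0 ≤ M' := (norm_nonneg _).trans (hM' x₀ (mem_closedBall_self (by linarith [φ.rOut_pos])))
  have heq : (φ.normed μ ⋆[ContinuousLinearMap.lsmul ℝ ℝ, μ] g) = fun x => ∫ t, φ.normed μ t * g (x - t) ∂μ :=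
    funext fun x => bump_convolution_apply μ φ g x
  rw [heq]
  refine hasFDerivAt_integral_of_dominated_of_fderiv_le (F' := fun x t => φ.normed μ t • fderiv ℝ g (x - t))
    (bound := fun t => ‖φ.normed μ t‖ * M') (s := ball x₀ 1) (ball_mem_nhds x₀ one_pos) ?_ ?_ ?_ ?_ ?_ ?_
  · exact Eventually.of_forall fun x =>
      (hφc.mul (hgc.comp (continuous_const.sub continuous_id))).aestronglyMeasurable
  · exact ((hφc.mul (hgc.comp (continuous_const.sub continuous_id))).integrable_of_hasCompactSupport
      (φ.hasCompactSupport_normed.mul_right))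
  · exact (hφc.smul (hDc.comp (continuous_const.sub continuous_id))).aestronglyMeasurable
  · refine Eventually.of_forall fun t x hx => ?_
    rw [norm_smul]
    by_cases ht : dist t 0 < φ.rOut
    · refine mul_le_mul_of_nonneg_left (hM' _ ?_) (norm_nonneg _)
      rw [mem_closedBall, dist_eq_norm]
      rw [mem_ball, dist_eq_norm] at hx
      rw [dist_zero_right] at ht
      calc ‖x - t - x₀‖ = ‖(x - x₀) - t‖ := by congr 1; abel
        _ ≤ ‖x - x₀‖ + ‖t‖ := norm_sub_le _ _
        _ ≤ 1 + φ.rOut := by linarith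
    · push Not at ht
      have h0 : φ.normed μ t = 0 := by rw [φ.normed_def, φ.zero_of_le_dist ht, zero_div]
      rw [h0, norm_zero, zero_mul, zero_mul]
  · exact φ.integrable_normed.norm.mul_const M'
  · refine Eventually.of_forall fun t x _ => ?_
    have h := ((hgd (x - t)).hasFDerivAt.comp x (hasFDerivAt_sub_const t)).const_mul (φ.normed μ t)
    refine h.congr_fderiv ?_
    rw [ContinuousLinearMap.comp_id]

/-- `D(φ ⋆ g)(x) v = (φ ⋆ (Dg · v))(x)` for any `C¹` profile. [folklore] -/
theorem fderiv_bump_convolution_apply_of_contDiff_one (φ : ContDiffBump (0 : E)) {g : E → ℝ}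
    (hg : ContDiff ℝ 1 g) (x₀ v : E) :
    fderiv ℝ (φ.normed μ ⋆[ContinuousLinearMap.lsmul ℝ ℝ, μ] g) x₀ v =
      (φ.normed μ ⋆[ContinuousLinearMap.lsmul ℝ ℝ, μ] (fun y => fderiv ℝ g y v)) x₀ := by
  rw [(hasFDerivAt_bump_convolution_of_contDiff_one μ φ hg x₀).fderiv,
    ContinuousLinearMap.integral_apply (integrable_bump_smul_fderiv μ φ hg x₀) v, bump_convolution_apply]
  congr 1

omit [NormedSpace ℝ E] [FiniteDimensional ℝ E] [MeasurableSpace E] [BorelSpace E] [μ.IsAddHaarMeasure] in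
/-- `(1 + ‖y - t‖)^m ≤ 2^m (1 + ‖y‖)^m` for `‖t‖ ≤ 1`. [folklore] -/
theorem one_add_norm_sub_pow_le {y t : E} (ht : ‖t‖ ≤ 1) (m : ℕ) :
    (1 + ‖y - t‖) ^ m ≤ 2 ^ m * (1 + ‖y‖) ^ m := by
  rw [← mul_pow]
  refine pow_le_pow_left₀ (by positivity) ?_ m
  have := norm_sub_le y t
  have := norm_nonneg y
  linarith

/-- **Polynomial growth is preserved by mollification at scale `≤ 1`** (values). [folklore] -/
theorem abs_bump_convolution_le_of_polyBound (φ : ContDiffBump (0 : E)) (hφ1 : φ.rOut ≤ 1)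
    {g : E → ℝ} {C₀ : ℝ} {m : ℕ} (hC₀ : 0 ≤ C₀) (hg : ∀ y, |g y| ≤ C₀ * (1 + ‖y‖) ^ m) (x : E) :
    |(φ.normed μ ⋆[ContinuousLinearMap.lsmul ℝ ℝ, μ] g) x| ≤ 2 ^ m * C₀ * (1 + ‖x‖) ^ m := by
  rw [bump_convolution_apply]
  set M : ℝ := 2 ^ m * C₀ * (1 + ‖x‖) ^ m with hM
  have hint : Integrable (fun t => φ.normed μ t * M) μ := φ.integrable_normed.mul_const M
  calc |∫ t, φ.normed μ t * g (x - t) ∂μ| ≤ ∫ t, φ.normed μ t * M ∂μ := by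
        rw [← Real.norm_eq_abs]
        refine norm_integral_le_of_norm_le hint (Eventually.of_forall fun t => ?_)
        rw [Real.norm_eq_abs, abs_mul, abs_of_nonneg (φ.nonneg_normed t)]
        by_cases ht : dist t 0 < φ.rOut
        · refine mul_le_mul_of_nonneg_left ((hg _).trans ?_) (φ.nonneg_normed t)
          rw [dist_zero_right] at ht
          calc C₀ * (1 + ‖x - t‖) ^ m ≤ C₀ * (2 ^ m * (1 + ‖x‖) ^ m) :=
                mul_le_mul_of_nonneg_left (one_add_norm_sub_pow_le (by linarith) m) hC₀
            _ = M := by rw [hM]; ring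
        · push Not at ht
          have h0 : φ.normed μ t = 0 := by rw [φ.normed_def, φ.zero_of_le_dist ht, zero_div]
          rw [h0, zero_mul, zero_mul]
    _ = M := by rw [integral_mul_const, φ.integral_normed, one_mul]

/-- **Polynomial growth is preserved by mollification at scale `≤ 1`** (gradients). [folklore] -/
theorem norm_fderiv_bump_convolution_le_of_polyBound (φ : ContDiffBump (0 : E)) (hφ1 : φ.rOut ≤ 1)
    {g : E → ℝ} (hg1 : ContDiff ℝ 1 g) {C₀ : ℝ} {m : ℕ} (hC₀ : 0 ≤ C₀)
    (hg : ∀ y, ‖fderiv ℝ g y‖ ≤ C₀ * (1 + ‖y‖) ^ m) (x : E) :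
    ‖fderiv ℝ (φ.normed μ ⋆[ContinuousLinearMap.lsmul ℝ ℝ, μ] g) x‖ ≤ 2 ^ m * C₀ * (1 + ‖x‖) ^ m := by
  rw [(hasFDerivAt_bump_convolution_of_contDiff_one μ φ hg1 x).fderiv]
  set M : ℝ := 2 ^ m * C₀ * (1 + ‖x‖) ^ m with hM
  have hint : Integrable (fun t => ‖φ.normed μ t‖ * M) μ := φ.integrable_normed.norm.mul_const M
  calc ‖∫ t, φ.normed μ t • fderiv ℝ g (x - t) ∂μ‖ ≤ ∫ t, ‖φ.normed μ t‖ * M ∂μ := by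
        refine norm_integral_le_of_norm_le hint (Eventually.of_forall fun t => ?_)
        rw [norm_smul]
        by_cases ht : dist t 0 < φ.rOut
        · refine mul_le_mul_of_nonneg_left ((hg _).trans ?_) (norm_nonneg _)
          rw [dist_zero_right] at ht
          calc C₀ * (1 + ‖x - t‖) ^ m ≤ C₀ * (2 ^ m * (1 + ‖x‖) ^ m) :=
                mul_le_mul_of_nonneg_left (one_add_norm_sub_pow_le (by linarith) m) hC₀
            _ = M := by rw [hM]; ring
        · push Not at ht
          have h0 : φ.normed μ t = 0 := by rw [φ.normed_def, φ.zero_of_le_dist ht, zero_div]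
          rw [h0, norm_zero, zero_mul, zero_mul]
    _ = M := by
        have e : (fun t => ‖φ.normed μ t‖ * M) = fun t => φ.normed μ t * M := by
          funext t; rw [Real.norm_eq_abs, abs_of_nonneg (φ.nonneg_normed t)]
        rw [e, integral_mul_const, φ.integral_normed, one_mul]

end Mollify

section MollifyExists

variable {E : Type*} [NormedAddCommGroup E] [NormedSpace ℝ E] [FiniteDimensional ℝ E] [MeasurableSpace E]
  [BorelSpace E]

/-- **Smoothing of `C¹` profiles of polynomial growth, with pointwise convergence of values and
gradients.** For `g ∈ C¹(E)` with `|g|, ‖Dg‖ ≤ C₀ (1 + ‖y‖)^m` there are smooth `g_j` with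
`|g_j|, ‖Dg_j‖ ≤ 2^m C₀ (1 + ‖y‖)^m`, `g_j → g` and `Dg_j(y) v → Dg(y) v` pointwise (normed bumps of
radius `1/(j+1) ≤ 1`). [folklore] -/
theorem exists_smooth_approx_of_contDiff_one_polyBound {g : E → ℝ} (hg : ContDiff ℝ 1 g) {C₀ : ℝ}
    {m : ℕ} (hgb : ∀ y, |g y| ≤ C₀ * (1 + ‖y‖) ^ m) (hDb : ∀ y, ‖fderiv ℝ g y‖ ≤ C₀ * (1 + ‖y‖) ^ m) :
    ∃ gs : ℕ → E → ℝ, (∀ j, ContDiff ℝ ∞ (gs j)) ∧ (∀ j y, |gs j y| ≤ 2 ^ m * C₀ * (1 + ‖y‖) ^ m) ∧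
      (∀ j y, ‖fderiv ℝ (gs j) y‖ ≤ 2 ^ m * C₀ * (1 + ‖y‖) ^ m) ∧
        (∀ y, Tendsto (fun j => gs j y) atTop (𝓝 (g y))) ∧
          (∀ y v, Tendsto (fun j => fderiv ℝ (gs j) y v) atTop (𝓝 (fderiv ℝ g y v))) := by
  set μ : Measure E := Measure.addHaar with hμ
  have hC₀ : 0 ≤ C₀ := by
    have h := (abs_nonneg _).trans (hgb 0)
    exact nonneg_of_mul_nonneg_left h (by positivity)
  have hgc : Continuous g := hg.continuous
  have hDc : ∀ v : E, Continuous fun y => fderiv ℝ g y v := fun v =>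
    (hg.continuous_fderiv one_ne_zero).clm_apply continuous_const
  have hr : ∀ j : ℕ, (1 : ℝ) / ((j : ℝ) + 2) < 1 / ((j : ℝ) + 1) := fun j =>
    one_div_lt_one_div_of_lt (by positivity) (by linarith)
  set φ : ℕ → ContDiffBump (0 : E) := fun j => ⟨1 / ((j : ℝ) + 2), 1 / ((j : ℝ) + 1), by positivity, hr j⟩
    with hφ
  have hφout : Tendsto (fun j => (φ j).rOut) atTop (𝓝 0) := by
    have : (fun j => (φ j).rOut) = fun j : ℕ => 1 / ((j : ℝ) + 1) := rfl
    rw [this]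
    exact tendsto_one_div_add_atTop_nhds_zero_nat
  have hφ1 : ∀ j, (φ j).rOut ≤ 1 := fun j => by
    show 1 / ((j : ℝ) + 1) ≤ 1
    rw [div_le_one (by positivity)]
    linarith [(Nat.cast_nonneg j : (0 : ℝ) ≤ j)]
  refine ⟨fun j => (φ j).normed μ ⋆[ContinuousLinearMap.lsmul ℝ ℝ, μ] g, fun j => ?_, fun j y => ?_,
    fun j y => ?_, fun y => ?_, fun y v => ?_⟩
  · exact (φ j).hasCompactSupport_normed.contDiff_convolution_left _ (φ j).contDiff_normed
      hgc.locallyIntegrable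
  · exact abs_bump_convolution_le_of_polyBound μ (φ j) (hφ1 j) hC₀ hgb y
  · exact norm_fderiv_bump_convolution_le_of_polyBound μ (φ j) (hφ1 j) hg hC₀ hDb y
  · exact ContDiffBump.convolution_tendsto_right_of_continuous hφout hgc y
  · have e : (fun j => fderiv ℝ ((φ j).normed μ ⋆[ContinuousLinearMap.lsmul ℝ ℝ, μ] g) y v) =
        fun j => ((φ j).normed μ ⋆[ContinuousLinearMap.lsmul ℝ ℝ, μ] (fun y => fderiv ℝ g y v)) y :=
      funext fun j => fderiv_bump_convolution_apply_of_contDiff_one μ (φ j) hg y v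
    rw [e]
    exact ContDiffBump.convolution_tendsto_right_of_continuous hφout (hDc v) y

/-- **Smoothing of `C¹` box profiles of polynomial growth** (the case used for cylinder observables of
the chain: profiles on `Fin (n + 1) → ℝ × ℝ`): smooth approximants with growth constant `2^m C₀` and
pointwise convergence of values and directional derivatives. [folklore] -/
theorem exists_smooth_approx_of_contDiff_one_polyBound_box :
    ∀ (n : ℕ) (g : (Fin (n + 1) → ℝ × ℝ) → ℝ), ContDiff ℝ 1 g → ∀ (C₀ : ℝ) (m : ℕ),
      (∀ y, |g y| ≤ C₀ * (1 + ‖y‖) ^ m) → (∀ y, ‖fderiv ℝ g y‖ ≤ C₀ * (1 + ‖y‖) ^ m) →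
      ∃ gs : ℕ → (Fin (n + 1) → ℝ × ℝ) → ℝ, (∀ j, ContDiff ℝ ((⊤ : ENat) : WithTop ENat) (gs j)) ∧
        (∀ j y, |gs j y| ≤ 2 ^ m * C₀ * (1 + ‖y‖) ^ m) ∧
        (∀ j y, ‖fderiv ℝ (gs j) y‖ ≤ 2 ^ m * C₀ * (1 + ‖y‖) ^ m) ∧
        (∀ y, Tendsto (fun j => gs j y) atTop (𝓝 (g y))) ∧
        (∀ y v, Tendsto (fun j => fderiv ℝ (gs j) y v) atTop (𝓝 (fderiv ℝ g y v))) :=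
  fun _ _ hg _ _ hgb hDb => exists_smooth_approx_of_contDiff_one_polyBound hg hgb hDb

end MollifyExists

end Summit.AtomisticToContinuum.FouriersLaw.Theorems.LocalOhmBirth

end
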